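import Summits.QuantumAdvantage.QuantumAdvantage.Theorems.NearExactIsExact.Negative.SkewProductResidual

/-!
# `NearExactIsExact` (stmt-QuantumAdvantage-14043) — negative lemma THEOREM TT (gen 38):
  twisted translations never realise the flat residual

**Context (the `31/32` habitat, BQ-11 strata).** In the last Maiorana–McFarland habitat of
`NearExactIsExact` one needs a biquadratic permutation `π` of `𝔽₂^{11}` and cubics `c₁, c₂` with
residual `c₁ ⊕ c₂∘π = 1_U`, `U` a flat of codimension `6` (DISPROOF.md §10, §24, §43 of the b2b cell).
After the gen-34/36 normal form (`naff(π) = 5`, sub-stratum `A = 0`) the map has the shape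
`π(u,t) = (γ u, B(u) ⊕ M(u)·t)` over the `6`-bit frame `u`, where `γ(u) = (ū, u₆ ⊕ g(ū))` has FIVE
affine coordinates and ONE quadratic coordinate, `B` is quadratic and `M(u)` is an affine family of
invertible matrices (DISPROOF.md §46.3). THEOREM A of the tree (`Negative.SkewProductResidual`,
gen 17) kills the translation case `M ≡ I` only when `γ` is such that `B` AND `B ∘ γ⁻¹` are quadratic.

**What this file proves (all `r`, no computation).** `twisted_translation_residual_ne_flat`: for ANY
map `γ : 𝔽₂⁶ → 𝔽₂⁶` whose coordinates are affine except one coordinate `i₀` of degree `≤ 2`, ANY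
quadratic family `B_k : 𝔽₂⁶ → 𝔽₂` (`k < r`) and ALL cubic `c₁, c₂` on `6 + r` bits,
`c₁(u,w) ⊕ c₂(γ u, w ⊕ B(u)) ≠ 1_{u = 0}` somewhere. Neither bijectivity of `γ` nor any hypothesis on
`B ∘ γ⁻¹` is needed; so the whole sub-stratum {`naff = 5`, `A = 0`, `M` constant} of BQ-11 is empty,
for every block length `r` (DISPROOF.md §46.7).

**Proof (top coefficient / parity).** Expand `c₂(v,w) = Σ_{|S| ≤ 3} w_S C_S(v)` (`coefC`, `expand`,
`deg C_S ≤ 3 − |S|`). The PAIR IDENTITY (`texp_split`; on a monomial `w_S` it reads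
`1 = [|S| ≤ 1] + C(|S|,2)` mod `2` for `|S| ≤ 3`):
`c₂(v, ρ) = Σ_{|S| ≤ 1} ρ_S C_S(v) + Σ_{|T| = 2} ρ_T · K_T(v)`, where
`K_T = Σ_{S ⊇ T} ρ_{S∖T} C_S` is the second `w`-difference of `w ↦ c₂(v,w)` at `ρ`
(`tTcoef_eq`, via `sum_powerset_prod_flip`). If the residual were `1_U` then, pulling everything back to
the source frame `u` (`ρ = B(u)`, `v = γ u`): `K_T(u) = ⨁_{J ⊆ T} c₂(γu, B(u) ⊕ 1_J) = ⨁_J c₁(u, 1_J)`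
is the `t`-Möbius coefficient `coefC c₁ T`, of degree `≤ 1`; `C_∅ ∘ γ` has degree `≤ 4` and
`C_{k} ∘ γ` degree `≤ 3` (`isDegLeFun_comp_twist`: one quadratic coordinate costs one degree). Hence
every summand of the pair identity has degree `≤ 5 < 6` in `u` and `u ↦ c₂(γ u, B u)` has EVEN weight
(`coreTT`, Ax/McEliece via `sum_ind_eq_zero_of_deg_five`) — but it equals `c₁(u,0) ⊕ 1_{u=0}`, of ODD
weight. (In exterior-algebra terms: the `t_i t_j`-coefficients force `Σ_k c_{ijk} ω_{B_k} = ε_{ij} ω_{γ₆}`,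
whence the top coefficient `[u₁⋯u₆] c₂(γu, B u) = 2·Σ ε_{ij} ω_{B_i} ω_{B_j} ω_{γ₆} = 0 ≠ 1`.)

HONEST FRAMING: the value here is a THEOREM (a kernel-checked negative lemma closing one infinite
sub-family of the last Maiorana–McFarland habitat of `NearExactIsExact`), NOT summit progress; the crux
and the summit are untouched.
-/

set_option linter.dupNamespace false -- D-0017: single-problem summit ⇒ `QuantumAdvantage.QuantumAdvantage` by design

namespace Summit.QuantumAdvantage.QuantumAdvantage.Theorems.NearExactIsExact.Negative.TwistedTranslation

open Finset
open Literature.Computability.QuantumComplexity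
open Literature.Computability.QuantumComplexity.BuzetChailloux (bxor)
open Summit.QuantumAdvantage.QuantumAdvantage.Theorems.CubicForrelation.NearExactIsExact
  (fc_isDegLeFun_comp stub_derivDegree fc_deg_bxor te_isDegLeFun_band)
open Summit.QuantumAdvantage.QuantumAdvantage.Theorems.NearExactIsExact.Negative.SkewProductCore
open Summit.QuantumAdvantage.QuantumAdvantage.Theorems.NearExactIsExact.Negative.SkewProductResidual

variable {r : ℕ}

/-! ### Flip sums and the `T`-coefficients `K_T` -/

/-- `Σ_{J ⊆ T} Π_{m ∈ S} [([m ∈ J] ⊕ ρ_m)] = [T ⊆ S] · Π_{m ∈ S ∖ T} [ρ_m]` in `𝔽₂`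
(the flipped factors sum to `1`, an unflippable flip cancels). [folklore] -/
theorem sum_powerset_prod_flip (ρ : Fin r → Bool) (T S : Finset (Fin r)) :
    ∑ J ∈ T.powerset, ∏ m ∈ S, ind (decide (m ∈ J) ^^ ρ m) =
      if T ⊆ S then ∏ m ∈ S \ T, ind (ρ m) else 0 := by
  induction T using Finset.induction_on generalizing S with
  | empty =>
    rw [powerset_empty, sum_singleton, if_pos (empty_subset S), sdiff_empty]
    exact prod_congr rfl fun m _ => by rw [decide_eq_false (notMem_empty m), Bool.false_xor]
  | insert k T hk ih =>
    rw [sum_powerset_insert hk, ← sum_add_distrib]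
    by_cases hkS : k ∈ S
    · have hpair : ∀ J ∈ T.powerset,
          ∏ m ∈ S, ind (decide (m ∈ J) ^^ ρ m) + ∏ m ∈ S, ind (decide (m ∈ insert k J) ^^ ρ m) =
            ∏ m ∈ S.erase k, ind (decide (m ∈ J) ^^ ρ m) := by
        intro J hJ
        have hkJ : k ∉ J := fun h => hk (mem_powerset.mp hJ h)
        have e : ∏ m ∈ S.erase k, ind (decide (m ∈ insert k J) ^^ ρ m) =
            ∏ m ∈ S.erase k, ind (decide (m ∈ J) ^^ ρ m) :=
          prod_congr rfl fun m hm => by simp [mem_insert, ne_of_mem_erase hm]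
        rw [← mul_prod_erase S (fun m => ind (decide (m ∈ J) ^^ ρ m)) hkS,
          ← mul_prod_erase S (fun m => ind (decide (m ∈ insert k J) ^^ ρ m)) hkS, e,
          decide_eq_false hkJ, decide_eq_true (mem_insert_self k J), Bool.false_xor, ← add_mul,
          add_comm, ind_true_xor_add, one_mul]
      have hsd : S.erase k \ T = S \ insert k T := by
        ext m; simp only [mem_sdiff, mem_erase, mem_insert, not_or]; tauto
      have hiff : T ⊆ S.erase k ↔ insert k T ⊆ S :=
        ⟨fun h => insert_subset hkS (h.trans (erase_subset k S)),
         fun h m hm => mem_erase.mpr ⟨fun hmk => hk (hmk ▸ hm), h (mem_insert_of_mem hm)⟩⟩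
      rw [sum_congr rfl hpair, ih (S.erase k), hsd]
      by_cases hTS : insert k T ⊆ S
      · rw [if_pos hTS, if_pos (hiff.mpr hTS)]
      · rw [if_neg hTS, if_neg (fun h => hTS (hiff.mp h))]
    · have e : ∀ J ∈ T.powerset, ∏ m ∈ S, ind (decide (m ∈ J) ^^ ρ m) +
          ∏ m ∈ S, ind (decide (m ∈ insert k J) ^^ ρ m) = 0 := by
        intro J _
        have e1 : ∏ m ∈ S, ind (decide (m ∈ insert k J) ^^ ρ m) = ∏ m ∈ S, ind (decide (m ∈ J) ^^ ρ m) :=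
          prod_congr rfl fun m hm => by
            have hmk : m ≠ k := fun h => hkS (h ▸ hm)
            simp [mem_insert, hmk]
        rw [e1, CharTwo.add_self_eq_zero]
      rw [sum_congr rfl e, sum_const_zero, if_neg (fun h => hkS (h (mem_insert_self k T)))]

/-- The `T`-coefficient `K_T(v) = Σ_{|S| ≤ 3, T ⊆ S} ρ_{S∖T}(v) C_S(v)` is an iterated difference:
`K_T(v) = Σ_{J ⊆ T} texp C (ρ v ⊕ 1_J) v`. [folklore] -/
theorem tTcoef_eq (ρ : Fin r → (Fin 6 → Bool) → Bool) (C : Finset (Fin r) → (Fin 6 → Bool) → Bool)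
    (T : Finset (Fin r)) (v : Fin 6 → Bool) :
    (∑ S ∈ (P3 r).filter (fun S => T ⊆ S), (∏ m ∈ S \ T, ind (ρ m v)) * ind (C S v)) =
      ∑ J ∈ T.powerset, texp C (fun m => decide (m ∈ J) ^^ ρ m v) v := by
  simp only [texp]
  rw [sum_comm, sum_filter]
  refine sum_congr rfl fun S _ => ?_
  rw [← sum_mul, sum_powerset_prod_flip (fun m => ρ m v) T S]
  split_ifs <;> simp

/-- **Pair identity.** `texp C ρ = Σ_{|S| ≤ 1} ρ_S C_S + Σ_{|T| = 2} ρ_T K_T` in `𝔽₂`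
(a monomial `ρ_S C_S`, `|S| ≤ 3`, is counted `[|S| ≤ 1] + C(|S|,2) ≡ 1` times). [folklore] -/
theorem texp_split (ρ : Fin r → (Fin 6 → Bool) → Bool) (C : Finset (Fin r) → (Fin 6 → Bool) → Bool)
    (v : Fin 6 → Bool) :
    texp C (fun m => ρ m v) v =
      ∑ S ∈ (P3 r).filter (fun S => S.card ≤ 1), (∏ m ∈ S, ind (ρ m v)) * ind (C S v) +
      ∑ T ∈ (univ : Finset (Fin r)).powersetCard 2, (∏ m ∈ T, ind (ρ m v)) *
        (∑ S ∈ (P3 r).filter (fun S => T ⊆ S), (∏ m ∈ S \ T, ind (ρ m v)) * ind (C S v)) := by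
  have hA : ∀ T : Finset (Fin r), (∏ m ∈ T, ind (ρ m v)) *
      (∑ S ∈ (P3 r).filter (fun S => T ⊆ S), (∏ m ∈ S \ T, ind (ρ m v)) * ind (C S v)) =
      ∑ S ∈ P3 r, if T ⊆ S then (∏ m ∈ S, ind (ρ m v)) * ind (C S v) else 0 := by
    intro T
    rw [sum_filter, mul_sum]
    refine sum_congr rfl fun S _ => ?_
    split_ifs with hTS
    · rw [← mul_assoc, mul_comm (∏ m ∈ T, ind (ρ m v)), prod_sdiff hTS]
    · exact mul_zero _
  have hfilter : ∀ S : Finset (Fin r),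
      ((univ : Finset (Fin r)).powersetCard 2).filter (fun T => T ⊆ S) = S.powersetCard 2 := by
    intro S; ext T
    simp only [mem_filter, mem_powersetCard, subset_univ, true_and]
    exact and_comm
  have hB : ∑ T ∈ (univ : Finset (Fin r)).powersetCard 2, (∏ m ∈ T, ind (ρ m v)) *
      (∑ S ∈ (P3 r).filter (fun S => T ⊆ S), (∏ m ∈ S \ T, ind (ρ m v)) * ind (C S v)) =
      ∑ S ∈ P3 r, ((S.card.choose 2 : ℕ) : ZMod 2) * ((∏ m ∈ S, ind (ρ m v)) * ind (C S v)) := by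
    rw [sum_congr rfl (fun T _ => hA T), sum_comm]
    refine sum_congr rfl fun S _ => ?_
    rw [← sum_filter, hfilter S, sum_const, card_powersetCard, nsmul_eq_mul]
  have c0 : Nat.choose 0 2 = 0 := by decide
  have c1 : Nat.choose 1 2 = 0 := by decide
  have c2 : Nat.choose 2 2 = 1 := by decide
  have c3 : Nat.choose 3 2 = 3 := by decide
  have z3 : ((3 : ℕ) : ZMod 2) = 1 := by decide
  have hC : ∀ S ∈ P3 r, (∏ m ∈ S, ind (ρ m v)) * ind (C S v) =
      (if S.card ≤ 1 then (∏ m ∈ S, ind (ρ m v)) * ind (C S v) else 0) +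
        ((S.card.choose 2 : ℕ) : ZMod 2) * ((∏ m ∈ S, ind (ρ m v)) * ind (C S v)) := by
    intro S hS
    have h3 := mem_P3.mp hS
    rcases (by omega : S.card = 0 ∨ S.card = 1 ∨ S.card = 2 ∨ S.card = 3) with h | h | h | h
    · rw [h, c0, Nat.cast_zero, zero_mul, add_zero, if_pos (by norm_num)]
    · rw [h, c1, Nat.cast_zero, zero_mul, add_zero, if_pos (le_refl 1)]
    · rw [h, c2, Nat.cast_one, one_mul, if_neg (by norm_num), zero_add]
    · rw [h, c3, z3, one_mul, if_neg (by norm_num), zero_add]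
  calc texp C (fun m => ρ m v) v = ∑ S ∈ P3 r, (∏ m ∈ S, ind (ρ m v)) * ind (C S v) := rfl
    _ = ∑ S ∈ P3 r, ((if S.card ≤ 1 then (∏ m ∈ S, ind (ρ m v)) * ind (C S v) else 0) +
          ((S.card.choose 2 : ℕ) : ZMod 2) * ((∏ m ∈ S, ind (ρ m v)) * ind (C S v))) := sum_congr rfl hC
    _ = _ := by rw [sum_add_distrib, ← sum_filter, ← hB]

/-! ### The abstract parity core of THEOREM TT -/

/-- **THEOREM TT, abstract core.** `ρ_k` quadratic, `deg C_∅ ≤ 5`, `deg C_{k} ≤ 3`, every `K_T`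
(`|T| = 2`) affine — all on the same `6`-bit frame. Then `v ↦ texp C (ρ v) v` has even weight:
every summand of the pair identity has degree `≤ 5 < 6`. [folklore] -/
theorem coreTT {ρ : Fin r → (Fin 6 → Bool) → Bool} (hρ : ∀ k, IsDegLeFun 2 (ρ k))
    {C : Finset (Fin r) → (Fin 6 → Bool) → Bool} (hC0 : IsDegLeFun 5 (C ∅))
    (hC1 : ∀ k, IsDegLeFun 3 (C {k}))
    (hT : ∀ T : Finset (Fin r), T.card = 2 →
      IsDegLeFun 1 (fun v => decide ((∑ S ∈ (P3 r).filter (fun S => T ⊆ S), (∏ m ∈ S \ T, ind (ρ m v)) * ind (C S v)) = 1))) :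
    ∑ v, texp C (fun m => ρ m v) v = 0 := by
  have hdeg : IsDegLeFun 5 (fun v => decide (texp C (fun m => ρ m v) v = 1)) := by
    have e : (fun v => decide (texp C (fun m => ρ m v) v = 1)) = fun v =>
        (decide ((∑ S ∈ (P3 r).filter (fun S => S.card ≤ 1), (∏ m ∈ S, ind (ρ m v)) * ind (C S v)) = 1) ^^
          decide ((∑ T ∈ (univ : Finset (Fin r)).powersetCard 2,
            (∏ m ∈ T, ind (ρ m v)) * (∑ S ∈ (P3 r).filter (fun S => T ⊆ S), (∏ m ∈ S \ T, ind (ρ m v)) * ind (C S v))) = 1)) := by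
      funext v; rw [texp_split, zmod2_decide_add]
    rw [e]
    refine fc_deg_bxor ?_ ?_
    · refine isDegLeFun_sum (fun S v => (∏ m ∈ S, ind (ρ m v)) * ind (C S v)) _ (fun S hS => ?_)
      rw [mem_filter] at hS
      have e1 : (fun v => decide ((∏ m ∈ S, ind (ρ m v)) * ind (C S v) = 1)) =
          fun v => (decide ((∏ m ∈ S, ind (ρ m v)) = 1) && C S v) := by
        funext v; rw [zmod2_decide_mul, decide_ind_eq_one]
      rw [e1]
      rcases Nat.le_one_iff_eq_zero_or_eq_one.mp hS.2 with h0 | h1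
      · rw [card_eq_zero] at h0
        subst h0
        exact (te_isDegLeFun_band (isDegLeFun_prod (fun m => ρ m) ∅ (fun m _ => hρ m)) hC0).mono (by simp)
      · obtain ⟨k, rfl⟩ := card_eq_one.mp h1
        exact (te_isDegLeFun_band (isDegLeFun_prod (fun m => ρ m) {k} (fun m _ => hρ m)) (hC1 k)).mono
          (by simp)
    · refine isDegLeFun_sum (fun T v => (∏ m ∈ T, ind (ρ m v)) *
        (∑ S ∈ (P3 r).filter (fun S => T ⊆ S), (∏ m ∈ S \ T, ind (ρ m v)) * ind (C S v))) _ (fun T hT2 => ?_)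
      have h2 : T.card = 2 := (mem_powersetCard.mp hT2).2
      have e1 : (fun v => decide ((∏ m ∈ T, ind (ρ m v)) *
          (∑ S ∈ (P3 r).filter (fun S => T ⊆ S), (∏ m ∈ S \ T, ind (ρ m v)) * ind (C S v)) = 1)) =
          fun v => (decide ((∏ m ∈ T, ind (ρ m v)) = 1) &&
            decide ((∑ S ∈ (P3 r).filter (fun S => T ⊆ S), (∏ m ∈ S \ T, ind (ρ m v)) * ind (C S v)) = 1)) := by
        funext v; rw [zmod2_decide_mul]
      rw [e1]
      exact (te_isDegLeFun_band (isDegLeFun_prod (fun m => ρ m) T (fun m _ => hρ m)) (hT T h2)).mono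
        (by omega)
  have h0 := sum_ind_eq_zero_of_deg_five hdeg
  simpa only [ind_decide_eq_one] using h0

/-! ### One quadratic coordinate costs one degree -/

/-- If `γ : 𝔽₂⁶ → 𝔽₂⁶` has affine coordinates except coordinate `i₀` of degree `≤ 2`, then
`deg (f ∘ γ) ≤ deg f + 1` (Shannon expansion in `v_{i₀}`: `f(γu) = f(γ⁰u) ⊕ γ_{i₀}(u)·(∂_{i₀}f)(γ⁰u)`).
[folklore] -/
theorem isDegLeFun_comp_twist {d : ℕ} {f : (Fin 6 → Bool) → Bool} (hf : IsDegLeFun (d + 1) f)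
    (γ : (Fin 6 → Bool) → (Fin 6 → Bool)) (i₀ : Fin 6)
    (hγa : ∀ i, i ≠ i₀ → IsDegLeFun 1 (fun u => γ u i)) (hγq : IsDegLeFun 2 (fun u => γ u i₀)) :
    IsDegLeFun (d + 2) (fun u => f (γ u)) := by
  have haff : ∀ (b : Bool) (i : Fin 6), IsDegLeFun 1 (fun u => Function.update (γ u) i₀ b i) := by
    intro b i
    by_cases hi : i = i₀
    · have e : (fun u => Function.update (γ u) i₀ b i) = fun _ => b :=
        funext fun u => by simp [hi]
      rw [e]; exact isDegLeFun_const 1 b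
    · have e : (fun u => Function.update (γ u) i₀ b i) = fun u => γ u i :=
        funext fun u => by simp [hi]
      rw [e]; exact hγa i hi
  have hflip : ∀ u, bxor (Function.update (γ u) i₀ false) (fun i => decide (i = i₀)) =
      Function.update (γ u) i₀ true := by
    intro u; funext i
    by_cases hi : i = i₀
    · subst hi; simp [bxor]
    · simp [bxor, hi]
  have e : (fun u => f (γ u)) = fun u =>
      (f (Function.update (γ u) i₀ false) ^^ (γ u i₀ &&
        (f (Function.update (γ u) i₀ false) ^^
          f (bxor (Function.update (γ u) i₀ false) (fun i => decide (i = i₀)))))) := by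
    funext u
    rw [hflip u]
    cases h : γ u i₀
    · have hu : Function.update (γ u) i₀ false = γ u := by rw [← h, Function.update_eq_self]
      rw [hu]; simp
    · have hu : Function.update (γ u) i₀ true = γ u := by rw [← h, Function.update_eq_self]
      rw [hu]
      generalize f (Function.update (γ u) i₀ false) = a
      generalize f (γ u) = b
      cases a <;> cases b <;> rfl
  rw [e]
  have hD : IsDegLeFun d (fun v => f v ^^ f (bxor v (fun i => decide (i = i₀)))) :=
    stub_derivDegree 6 d f _ hf
  have h1 : IsDegLeFun (d + 1) (fun u => f (Function.update (γ u) i₀ false)) :=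
    fc_isDegLeFun_comp hf (fun u => Function.update (γ u) i₀ false) (haff false) (by omega)
  have h2 : IsDegLeFun d (fun u => f (Function.update (γ u) i₀ false) ^^
      f (bxor (Function.update (γ u) i₀ false) (fun i => decide (i = i₀)))) :=
    fc_isDegLeFun_comp hD (fun u => Function.update (γ u) i₀ false) (haff false) (by omega)
  exact fc_deg_bxor (h1.mono (by omega)) ((te_isDegLeFun_band hγq h2).mono (by omega))

/-! ### THEOREM TT -/

/-- Expansion through `γ`, with the `t`-Möbius coefficient family of `c₂` pulled back to the source
frame: `c₂(γ u, w) = texp (S ↦ C_S ∘ γ) w u`. [folklore] -/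
theorem expand_comp (c₂ : (Fin (6 + r) → Bool) → Bool) (h₂ : IsDegLeFun 3 c₂)
    (γ : (Fin 6 → Bool) → (Fin 6 → Bool)) (u : Fin 6 → Bool) (w : Fin r → Bool) :
    ind (c₂ (Fin.append (γ u) w)) = texp (fun S u => coefC c₂ S (γ u)) w u := by
  rw [expand c₂ h₂]; rfl

/-- **THEOREM TT (gen 38).** `γ : 𝔽₂⁶ → 𝔽₂⁶` with affine coordinates except one coordinate `i₀` of
degree `≤ 2` (e.g. `γ(u) = (ū, u₆ ⊕ g(ū))`), `B_k` quadratic, `c₁, c₂` cubic on `6 + r` bits. Then the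
residual of the twisted translation `(u,w) ↦ (γ u, w ⊕ B u)` is NOT the indicator of the flat
`{u = 0}` — for every `r`; no bijectivity and no hypothesis on `B ∘ γ⁻¹` is needed. Kills the
sub-stratum {`naff = 5`, `A = 0`, `M` constant} of BQ-11 (DISPROOF.md §46.7). [folklore] -/
theorem twisted_translation_residual_ne_flat (γ : (Fin 6 → Bool) → (Fin 6 → Bool)) (i₀ : Fin 6)
    (hγa : ∀ i, i ≠ i₀ → IsDegLeFun 1 (fun u => γ u i)) (hγq : IsDegLeFun 2 (fun u => γ u i₀))
    (B : Fin r → (Fin 6 → Bool) → Bool) (hB : ∀ k, IsDegLeFun 2 (B k))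
    (c₁ c₂ : (Fin (6 + r) → Bool) → Bool) (h₁ : IsDegLeFun 3 c₁) (h₂ : IsDegLeFun 3 c₂) :
    ¬ ∀ (u : Fin 6 → Bool) (w : Fin r → Bool),
      (c₁ (Fin.append u w) ^^ c₂ (Fin.append (γ u) (fun k => w k ^^ B k u))) =
        decide (∀ i, u i = false) := by
  intro h
  have hx : ∀ (u : Fin 6 → Bool) (w : Fin r → Bool),
      c₂ (Fin.append (γ u) (fun k => w k ^^ B k u)) =
        (c₁ (Fin.append u w) ^^ decide (∀ i, u i = false)) :=
    fun u w => bool_solve _ _ _ (h u w)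
  -- (T) the pair coefficients are the `t`-Möbius coefficients of `c₁`, hence affine
  have hT : ∀ T : Finset (Fin r), T.card = 2 →
      IsDegLeFun 1 (fun u => decide ((∑ S ∈ (P3 r).filter (fun S => T ⊆ S), (∏ m ∈ S \ T, ind (B m u)) * ind (coefC c₂ S (γ u))) = 1)) := by
    intro T hT2
    have h40 : ((2 ^ 2 : ℕ) : ZMod 2) = 0 := by decide
    have e : (fun u => decide ((∑ S ∈ (P3 r).filter (fun S => T ⊆ S), (∏ m ∈ S \ T, ind (B m u)) * ind (coefC c₂ S (γ u))) = 1)) =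
        coefC c₁ T := by
      funext u
      rw [tTcoef_eq B (fun S u => coefC c₂ S (γ u)) T u]
      have hJ : ∀ J ∈ T.powerset, texp (fun S u => coefC c₂ S (γ u)) (fun m => decide (m ∈ J) ^^ B m u) u =
          ind (c₁ (bxor (emb r u) (L J))) + ind (decide (∀ i, u i = false)) := by
        intro J _
        rw [← expand_comp c₂ h₂, emb_bxor_L, ← ind_xor, ← hx u (indic J)]
        rfl
      rw [sum_congr rfl hJ, sum_add_distrib, sum_const, card_powerset, hT2, nsmul_eq_mul, h40,
        zero_mul, add_zero]
      rfl
    rw [e]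
    simpa [hT2] using coefC_deg c₁ h₁ T
  -- (0), (1): `C_∅ ∘ γ` has degree ≤ 4 ≤ 5 and `C_{k} ∘ γ` degree ≤ 3
  have hC0 : IsDegLeFun 5 (fun u => coefC c₂ (∅ : Finset (Fin r)) (γ u)) := by
    have h := coefC_deg c₂ h₂ (∅ : Finset (Fin r))
    rw [card_empty] at h
    exact (isDegLeFun_comp_twist (d := 2) h γ i₀ hγa hγq).mono (by norm_num)
  have hC1 : ∀ k : Fin r, IsDegLeFun 3 (fun u => coefC c₂ {k} (γ u)) := fun k => by
    have h := coefC_deg c₂ h₂ ({k} : Finset (Fin r))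
    rw [card_singleton] at h
    exact isDegLeFun_comp_twist (d := 1) h γ i₀ hγa hγq
  -- parity: even weight by the core ...
  have hcore := coreTT (C := (fun S u => coefC c₂ S (γ u))) hB hC0 hC1 hT
  have hsum1 : ∑ u, ind (c₂ (Fin.append (γ u) (fun k => B k u))) = 0 := by
    rw [← hcore]
    exact sum_congr rfl fun u _ => expand_comp c₂ h₂ γ u _
  -- ... but the zero section `u ↦ c₂(γ u, B u) = c₁(u,0) ⊕ 1_{u=0}` has odd weight
  have h0 : ∀ u : Fin 6 → Bool,
      c₂ (Fin.append (γ u) (fun k => B k u)) = (c₁ (emb r u) ^^ decide (∀ i, u i = false)) := by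
    intro u
    have h' := hx u (fun _ => false)
    simp only [Bool.false_xor] at h'
    exact h'
  have hc₁ : ∑ u, ind (c₁ (emb r u)) = 0 :=
    sum_ind_eq_zero_of_deg_five (fc_isDegLeFun_comp h₁ (emb r) (emb_coord_deg r) (by norm_num))
  have hδ : ∑ u : Fin 6 → Bool, ind (decide (∀ i, u i = false)) = 1 := by
    rw [Finset.sum_eq_single (fun _ => false)]
    · simp
    · intro u _ hu
      have hu' : ¬ ∀ i, u i = false := fun h' => hu (funext h')
      simp [hu']
    · intro h'
      exact absurd (mem_univ _) h'
  have hsum2 : ∑ u, ind (c₂ (Fin.append (γ u) (fun k => B k u))) = 1 := by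
    simp_rw [h0, ind_xor]
    rw [sum_add_distrib, hc₁, hδ, zero_add]
  exact zero_ne_one (hsum1.symm.trans hsum2)

end Summit.QuantumAdvantage.QuantumAdvantage.Theorems.NearExactIsExact.Negative.TwistedTranslation
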